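import Mathlib
import HarnessLib
import Summits.Ventures.LatticeQCDFlow.Exactness.SphereProjectionChart
import Summits.Ventures.LatticeQCDFlow.Exactness.SphereFamilyLeapfrog
import Summits.Ventures.LatticeQCDFlow.Exactness.LeapfrogHMCDoeblin

/-!
# The projection chart on a finite family of spheres: the product uniform law of a product of caps is dominated by product Lebesgue measure on the product of tangent balls pushed through the sitewise charts

HONEST FRAMING: exact (Metropolis-corrected) sampling algorithms for lattice gauge theory;
figures of merit are autocorrelation/cost numbers at stated couplings and volumes; no
continuum-physics claim.

Venture `LatticeQCDFlow` (cell pub-lqcd), topic `Exactness`, FANOUT row 9 (eng-latcore; roadmap Step 3 for the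
`cpn_2d` sphere FAMILY — the position space `Π i, S^{k i + 1}` of gen-16's `SphereFamilyLeapfrog.lean` — toward
multi-step HMC, HOME/eng-latcore/HANDOFF.md GEN-19/20).  NEW WORK of the cell over the tree
(`SphereProjectionChart.lean`: `projBall`, `projChartConst`, **`uniformSphere_restrict_sphereCap_le`** — one sphere,
every centre; gen-16's `SphereFamilyLeapfrog.lean`: `FamE`, `FamS`; `LeapfrogHMCDoeblin.lean`: `smul_pi_le_pi`) and
Mathlib (`Measure.restrict_pi_pi`, `Measure.pi_map_pi`); nothing is cited as a fact; no number beyond the product of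
the one-sphere constants.

* `pi_le_smul_pi` (`μᵢ ≤ cᵢ • νᵢ` with `cᵢ ≠ 0, ⊤` ⇒ `⊗μ ≤ (∏ cᵢ) • ⊗ν`, from the tree's `smul_pi_le_pi`); no new
  definitions (the tangent coordinate space at index `i` is written `ℝ^{k i + 1} = EuclideanSpace ℝ (Fin (k i + 1))`).
* **`pi_uniformSphere_restrict_piCap_le`** — for `0 < r < π/2` and every configuration `x`, there are rotations
  `O i ∈ SO(k i + 2)` with `O i e₀ = x i` such that
  `(⊗ᵢ uniformSphere)|_{Πᵢ cap(xᵢ, r)} ≤ (∏ᵢ projChartConst (k i) r) • ((⊗ᵢ Leb)|_{Πᵢ ball 0 (sin r)}).map (y ↦ (Oᵢ (projBall yᵢ))ᵢ)`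
  (the set `Πᵢ cap(xᵢ, r)` is `SphereFamilyCapChaining.piCap x r`; the box `Πᵢ ball 0 (sin r)` is the sup-norm ball
  `ball 0 (sin r)` of `Π i, ℝ^{k i + 1}` by `ball_pi`).
* `prod_projChartConst_ne_zero` / `_ne_top`.

NOT CLAIMED: anything beyond the product of the one-sphere statements (Steps 4–5 of the roadmap, constants).
-/

noncomputable section

namespace Summit.Ventures.LatticeQCDFlow.Exactness

open MeasureTheory Measure Metric Set Real
open scoped ENNReal

/-! ## §1 Product of one-sided dominations -/

section Pi

variable {ι : Type*} [Fintype ι] {X : ι → Type*} [∀ i, MeasurableSpace (X i)]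
  {μ ν : ∀ i, Measure (X i)} [∀ i, SigmaFinite (μ i)] [∀ i, SigmaFinite (ν i)] {c : ι → ℝ≥0∞}

/-- **Coordinate-wise dominations multiply**: `μᵢ ≤ cᵢ • νᵢ` for every `i`, with `cᵢ ≠ 0, ⊤`, gives
`Measure.pi μ ≤ (∏ᵢ cᵢ) • Measure.pi ν` (the tree's `smul_pi_le_pi` applied to `cᵢ⁻¹ • μᵢ ≤ νᵢ`). -/
theorem pi_le_smul_pi (hc0 : ∀ i, c i ≠ 0) (hct : ∀ i, c i ≠ ⊤) (h : ∀ i, μ i ≤ c i • ν i) :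
    Measure.pi μ ≤ (∏ i, c i) • Measure.pi ν := by
  classical
  have h' : ∀ i, (c i)⁻¹ • μ i ≤ ν i := fun i => by
    calc (c i)⁻¹ • μ i ≤ (c i)⁻¹ • (c i • ν i) := by
          refine Measure.le_iff'.2 fun A => ?_
          simp only [Measure.smul_apply, smul_eq_mul]
          exact mul_le_mul_of_nonneg_left (Measure.le_iff'.1 (h i) A) zero_le
      _ = ν i := by rw [smul_smul, ENNReal.inv_mul_cancel (hc0 i) (hct i), one_smul]
  have hpi := smul_pi_le_pi h'
  have hprod : (∏ i, c i) * ∏ i, (c i)⁻¹ = 1 := by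
    rw [← Finset.prod_mul_distrib]
    exact Finset.prod_eq_one fun i _ => ENNReal.mul_inv_cancel (hc0 i) (hct i)
  calc Measure.pi μ = (∏ i, c i) • ((∏ i, (c i)⁻¹) • Measure.pi μ) := by
        rw [smul_smul, hprod, one_smul]
    _ ≤ (∏ i, c i) • Measure.pi ν := by
        refine Measure.le_iff'.2 fun A => ?_
        simp only [Measure.smul_apply, smul_eq_mul]
        exact mul_le_mul_of_nonneg_left (Measure.le_iff'.1 hpi A) zero_le

end Pi

/-! ## §2 The family of projection charts -/

section Family

variable {ι : Type*} [Fintype ι] (k : ι → ℕ)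

/-- The product of the one-sphere constants is not zero (`0 < r < π/2`, indeed `|r| < π/2`). -/
theorem prod_projChartConst_ne_zero {r : ℝ} (hr0 : -(π / 2) < r) (hr : r < π / 2) :
    (∏ i, projChartConst (k i) r) ≠ 0 :=
  Finset.prod_ne_zero_iff.2 fun i _ => projChartConst_ne_zero (k i) hr0 hr

/-- The product of the one-sphere constants is finite. -/
theorem prod_projChartConst_ne_top (r : ℝ) : (∏ i, projChartConst (k i) r) ≠ ⊤ :=
  ENNReal.prod_ne_top fun i _ => projChartConst_ne_top (k i) r

variable {k}

/-- **THE PROJECTION CHARTS DOMINATE THE PRODUCT UNIFORM LAW OF A PRODUCT OF CAPS, FROM EVERY CONFIGURATION.**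
For `0 < r < π/2` and every `x : Π i, S^{k i + 1}` there are rotations `O i ∈ SO(k i + 2)` with `O i e₀ = x i` and
`(⊗ᵢ uniformSphere)|_{Πᵢ cap(xᵢ, r)} ≤ (∏ᵢ projChartConst (k i) r) • ((⊗ᵢ Lebesgue)|_{Πᵢ ball 0 (sin r)}).map (y ↦ (Oᵢ (projBall yᵢ))ᵢ)`. -/
theorem pi_uniformSphere_restrict_piCap_le (x : Π i, FamS k i) {r : ℝ} (hr0 : 0 < r) (hr : r < π / 2) :
    ∃ O : Π i, Matrix.specialOrthogonalGroup (Fin (k i + 2)) ℝ, (∀ i, actSO (O i) (polarAxisPt (k i)) = x i) ∧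
      (Measure.pi fun i => uniformSphere (volume : Measure (FamE k i))).restrict
          (Set.pi univ fun i => sphereCap (x i) r) ≤
        (∏ i, projChartConst (k i) r) •
          ((Measure.pi fun i => (volume : Measure (EuclideanSpace ℝ (Fin (k i + 1))))).restrict
              (Set.pi univ fun i => ball (0 : EuclideanSpace ℝ (Fin (k i + 1))) (sin r))).map
            fun y i => actSO (O i) (projBall (k i) (y i)) := by
  classical
  choose O hO hle using fun i => uniformSphere_restrict_sphereCap_le (k i) (x i) hr0 hr
  refine ⟨O, hO, ?_⟩
  haveI hfin : ∀ i, IsFiniteMeasure ((volume : Measure (EuclideanSpace ℝ (Fin (k i + 1)))).restrict (ball (0 : EuclideanSpace ℝ (Fin (k i + 1))) (sin r))) :=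
    fun i => ⟨by rw [Measure.restrict_apply_univ]; exact measure_ball_lt_top⟩
  have hg : ∀ i, Measurable fun y : EuclideanSpace ℝ (Fin (k i + 1)) => actSO (O i) (projBall (k i) y) :=
    fun i => (measurable_actSO_right (O i)).comp (measurable_projBall (k i))
  rw [Measure.restrict_pi_pi, Measure.restrict_pi_pi,
    Measure.pi_map_pi (fun i => (hg i).aemeasurable)]
  exact pi_le_smul_pi (fun i => projChartConst_ne_zero (k i) (by linarith [pi_pos]) hr)
    (fun i => projChartConst_ne_top (k i) r) hle

/-- The box of tangent coordinates is the sup-norm ball of `Π i, ℝ^{k i + 1}` (`sin r > 0` for `0 < r < π`). -/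
theorem pi_ball_eq_ball {ρ : ℝ} (hρ : 0 < ρ) :
    (Set.pi univ fun i => ball (0 : EuclideanSpace ℝ (Fin (k i + 1))) ρ) = ball (0 : Π i, EuclideanSpace ℝ (Fin (k i + 1))) ρ :=
  (ball_pi (0 : Π i, EuclideanSpace ℝ (Fin (k i + 1))) hρ).symm

end Family

end Summit.Ventures.LatticeQCDFlow.Exactness

end
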